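import Summits.CriticalPhenomena.CardyFormulaZ2.Theorems.CardyBoundaryCoulombGasHalfPlaneMarkDensityLawTwoArmPoint
import Summits.CriticalPhenomena.CardyFormulaZ2.Theorems.CardyBoundaryCoulombGasHalfPlaneMarkDensityLawSymmDiffInclusion
import Summits.CriticalPhenomena.CardyFormulaZ2.Theorems.CardyBoundaryCoulombGasHalfPlaneMarkDensityLawIsolationIndep
import Summits.CriticalPhenomena.CardyFormulaZ2.Theorems.CardyBoundaryCoulombGasHalfPlaneMarkDensityLawShiftLipschitz
import Summits.CriticalPhenomena.CardyFormulaZ2.Theorems.CardyBoundaryCoulombGasHalfPlaneMarkDensityLawDensityFromIncrements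
import Summits.CriticalPhenomena.CardyFormulaZ2.Theorems.HalfPlaneMarkDensityLaw.Negative.RatioTemplate

/-!
# Line `Sketch` — the REDUCTION of the crux `HalfPlaneMarkDensityLaw` (stmt-CriticalPhenomena-5661) to the
# collinear half-plane Cardy law C⁺ (registered extra stub `stub_reduction`)

The lead's skeleton composition with every provable stub landed: exact translation + telescoping
(`Negative.MarkEvents`), the four-case symmetric-difference inclusion (`stub_symmDiffInclusion`),
independence in disjoint half-boxes (`stub_isolationIndep`), the half-plane two-arm point bound
(`stub_twoArmPoint`) — assembled into the `n⁻²`-Lipschitz bound (`stub_shiftLipschitz_of`) — and the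
difference-quotient lemma (`stub_densityFromIncrements`) give: C⁺ (collinear half-plane Cardy for
bond-`ℤ²`, the one stub of open-problem strength, stated here as the hypothesis) implies the crux BY NAME.
With the converse file (`stub_converse`) the crux is EQUIVALENT to C⁺.
-/

noncomputable section

namespace Summit.CriticalPhenomena.CardyFormulaZ2.Cruxes.HalfPlaneMarkDensityLaw.SketchLine

open Literature.Probability.Percolation Literature.Probability.LatticeModels
open Literature.Probability.RandomPlanarGeometry
open MeasureTheory Filter Set
open scoped Topology
open Summit.CriticalPhenomena.CardyFormulaZ2.Theses.CardyBoundaryCoulombGas (HalfPlaneMarkDensityLaw)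
open Summit.CriticalPhenomena.CardyFormulaZ2.Theorems.HalfPlaneMarkDensityLaw.Negative

/-- Cardy's function `F` (the `RandomPlanarGeometry` copy). -/
local notation "𝔽" => Literature.Probability.RandomPlanarGeometry.cardyFunction

/-- STUB L, applied: the lattice mark density is `n⁻²`-Lipschitz on compact windows of `(c,∞)`. [folklore] -/
theorem shiftLipschitz (a b c x₀ x₁ : ℝ) (hab : a < b) (hbc : b < c) (hcx : c < x₀) (hx : x₀ ≤ x₁) :
    ∃ C : ℝ, ∀ n : ℕ, 1 ≤ n → ∀ k k' : ℤ, ⌊x₀ * n⌋ ≤ k → k ≤ k' → k' ≤ ⌊x₁ * n⌋ →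
      |μ.real (firstHit halfPlane (arcA a b n) ⌊c * n⌋ k') -
          μ.real (firstHit halfPlane (arcA a b n) ⌊c * n⌋ k)| ≤ C * (k' - k) / (n : ℝ) ^ 2 :=
  stub_shiftLipschitz a b c x₀ x₁ hab hbc hcx hx

/-- Exact telescoping over a right window (tree `measureReal_crossing_window`), in the indexing of STUB D:
for `x ≤ y`, `Σ_{i < ⌊yn⌋−⌊xn⌋} P[E(⌊xn⌋+1+i)] = G_n(y) − G_n(x)`. [folklore] -/
theorem window_sum_eq (a b c x y : ℝ) (hcx : c < x) (hxy : x ≤ y) (n : ℕ) :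
    ∑ i ∈ Finset.range (⌊y * n⌋ - ⌊x * n⌋).toNat,
        μ.real (firstHit halfPlane (arcA a b n) ⌊c * n⌋ (⌊x * n⌋ + 1 + i)) =
      μ.real (openCrossing halfPlane (arcA a b n) (rowIcc ⌊c * n⌋ ⌊y * n⌋)) -
        μ.real (openCrossing halfPlane (arcA a b n) (rowIcc ⌊c * n⌋ ⌊x * n⌋)) := by
  have hk : ⌊c * (n : ℝ)⌋ ≤ ⌊x * (n : ℝ)⌋ + 1 := by
    have := Int.floor_le_floor (mul_le_mul_of_nonneg_right hcx.le (Nat.cast_nonneg n)); omega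
  have hM : ((⌊y * n⌋ - ⌊x * n⌋).toNat : ℤ) = ⌊y * n⌋ - ⌊x * n⌋ :=
    Int.toNat_of_nonneg (sub_nonneg.2 (Int.floor_le_floor (mul_le_mul_of_nonneg_right hxy (Nat.cast_nonneg n))))
  have h := measureReal_crossing_window halfPlane (arcA a b n) hk (⌊y * n⌋ - ⌊x * n⌋).toNat
  rw [hM, show ⌊x * (n : ℝ)⌋ + (⌊y * n⌋ - ⌊x * n⌋) = ⌊y * n⌋ by ring] at h
  linarith

/-- **`C⁺ → HalfPlaneMarkDensityLaw`** (registered extra stub `stub_reduction` of the line): the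
collinear half-plane Cardy law for bond-`ℤ²` implies the crux BY NAME — unconditionally in everything
else (translation, telescoping, four-case inclusion, independence, two-arm point bound, difference
quotient, `d/dx F(η) = density`). [folklore] -/
theorem stub_reduction :
    (∀ a b c y : ℝ, a < b → b < c → c < y →
      Tendsto (fun n : ℕ ↦ μ.real (openCrossing halfPlane (arcA a b n) (rowIcc ⌊c * n⌋ ⌊y * n⌋))) atTop
        (𝓝 (Literature.Probability.RandomPlanarGeometry.cardyFunction
          (Literature.Probability.RandomPlanarGeometry.crossRatio ![a, b, c, y])))) →
    HalfPlaneMarkDensityLaw := by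
  intro hC
  rw [halfPlaneMarkDensityLaw_iff]
  intro a b c x hab hbc hcx
  obtain ⟨C, hL⟩ := shiftLipschitz a b c x (x + 1) hab hbc hcx (by linarith)
  have hD := stub_densityFromIncrements
    (fun n k ↦ μ.real (firstHit halfPlane (arcA a b n) ⌊c * n⌋ k))
    (fun y ↦ 𝔽 (Literature.Probability.RandomPlanarGeometry.crossRatio ![a, b, c, y]))
    x (density a b c x) 1 C one_pos ?_ ?_ (hasDerivAt_cardy_crossRatio hab hbc hcx)
  · exact hD
  · intro y hxy _
    refine ((hC a b c y hab hbc (hcx.trans hxy)).sub (hC a b c x hab hbc hcx)).congr fun n ↦ ?_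
    exact (window_sum_eq a b c x y hcx hxy.le n).symm
  · intro n hn k k' hk hkk' hk'
    exact hL n hn k k' hk hkk' hk'

end Summit.CriticalPhenomena.CardyFormulaZ2.Cruxes.HalfPlaneMarkDensityLaw.SketchLine
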